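import Literature.MathematicalPhysics.QuantumChemistry.RDMSpatialSymmetryBlocks
import Literature.MathematicalPhysics.QuantumChemistry.SecondQuantizedHamiltonian
import HarnessLib

/-!
# Spatial symmetry of the molecular Hamiltonian: the sign-character operators commute with `Ĥ`

Topic `Literature/MathematicalPhysics/QuantumChemistry`; part 2 of `RDMSpatialSymmetryBlocks.lean`
(Mazziotti 2007 §II.F eq. (95): the reduced density matrices of a symmetry-adapted state are blocked by
irreducible representation). That file takes the symmetry adaptation `U_S ψ = ±ψ` as a hypothesis; this
file vendors the standard reason it is available for the eigenstates of a molecular Hamiltonian read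
from an integral file: for an ABELIAN point group (`D_{2h}` and subgroups; FCIDUMP `ORBSYM`,
Knowles–Handy 1989) every spatial orbital `p` carries a sign character `χ(p) = ±1` per group generator,
"integrals (pq|rs) vanish unless the direct product of the symmetries of p, q, r, s contains the totally
symmetric representation" (Knowles–Handy 1989 §2, the ORBSYM convention; for sign characters:
`h_pq = 0` unless `χ(p)χ(q) = 1`, `(pq|rs) = 0` unless `χ(p)χ(q)χ(r)χ(s) = 1`), and then the
Fock-space operator `U_S` of the character (`S` = the spin orbitals over the spatial orbitals `S₀` with
`χ = −1`) COMMUTES with the second-quantized Hamiltonian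
`Ĥ = Σ h_pq E_pq + ½ Σ (pq|rs) e_pqrs + h_nuc` of `SecondQuantizedHamiltonian.lean`
(Helgaker–Jørgensen–Olsen (2000) eq. (2.2.18)). PROVED here (0 sorry, no named facts):

* `orbitalSignOp_mul_singletExcitation`: `U_S E_pq = χ(p)χ(q) E_pq U_S` (both spin components of the
  singlet excitation operator carry the same spatial character);
* `orbitalSignOp_mul_twoElectronExcitation`: `U_S e_pqrs = χ(p)χ(q)χ(r)χ(s) e_pqrs U_S`;
* `orbitalSignOp_commute_molecularHamiltonian`: under the integral selection rules above,
  `U_S Ĥ = Ĥ U_S`; hence (`orbitalSignOp_mulVec_eigenvector`) `U_S` maps every eigenvector of `Ĥ` to an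
  eigenvector with the same eigenvalue, so `ψ ± U_S ψ` are symmetry-adapted eigenvectors
  (`U_S (ψ ± U_S ψ) = ±(ψ ± U_S ψ)`, `orbitalSignOp_mulVec_symmetrise`) — the input hypothesis of the
  blocking theorems of part 1, available in every eigenspace.

## References
* D. A. Mazziotti, *Variational two-electron reduced-density-matrix theory*, in: Reduced-Density-Matrix
  Mechanics, Adv. Chem. Phys. 134 (Wiley, 2007) 21–59, §II.F eq. (95).
  [cite: Mazziotti2007RDMChapter, §II.F eq. (95)]
* P. J. Knowles, N. C. Handy, *A determinant based full configuration interaction program*,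
  Comput. Phys. Commun. 54 (1989) 75, §2 (FCIDUMP `ORBSYM`; symmetry-zero integrals are omitted).
  [cite: KnowlesHandy1989, §2]
* T. Helgaker, P. Jørgensen, J. Olsen, *Molecular Electronic-Structure Theory* (Wiley, 2000),
  eq. (2.2.18). [cite: HelgakerJorgensenOlsen2000, eq. (2.2.18)]
-/

noncomputable section

namespace Literature.MathematicalPhysics.QuantumChemistry

open Matrix Finset Literature.MathematicalPhysics.QuantumLattice
open scoped ComplexOrder

variable {Λ : Type*} [LinearOrder Λ] [Fintype Λ]

/-- The character of a product of `±1` characters is `±1`. [folklore] -/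
private theorem sign_mul_sign_cases (a b : Prop) [Decidable a] [Decidable b] :
    (if a then (-1 : ℂ) else 1) * (if b then (-1 : ℂ) else 1) = 1 ∨
      (if a then (-1 : ℂ) else 1) * (if b then (-1 : ℂ) else 1) = -1 := by
  split_ifs <;> norm_num

/-- A term `c • X` whose operator has character `η` commutes with `U` as soon as `η = 1` or the
coefficient vanishes — the two cases allowed by an integral selection rule. [folklore] -/
private theorem commute_smul_of_sign {n : Type*} [Fintype n] [DecidableEq n] {U X : Matrix n n ℂ}
    {η c : ℂ} (hX : U * X = η • (X * U)) (h : η = 1 ∨ c = 0) : Commute (c • X) U := by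
  rcases h with rfl | rfl
  · rw [one_smul] at hX
    have hc : Commute X U := hX.symm
    exact hc.smul_left c
  · rw [zero_smul]; exact Commute.zero_left U

/-- **`E_pq` carries the spatial character `χ(p)χ(q)`**: for the spin-orbital set `S` lying over the
spatial orbitals `S₀` (`pσ ∈ S ↔ p ∈ S₀`), `U_S E_pq = χ(p)χ(q) · E_pq U_S`.
[cite: Mazziotti2007RDMChapter, §II.F eq. (95)] -/
theorem orbitalSignOp_mul_singletExcitation {S : Finset (Orb Λ)} {S₀ : Finset Λ}
    (hS : ∀ (p : Λ) (σ : Fin 2), orb p σ ∈ S ↔ p ∈ S₀) (p q : Λ) :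
    orbitalSignOp S * singletExcitation p q =
      ((if p ∈ S₀ then (-1 : ℂ) else 1) * (if q ∈ S₀ then (-1 : ℂ) else 1)) •
        (singletExcitation p q * orbitalSignOp S) := by
  unfold singletExcitation
  rw [Finset.mul_sum, Finset.sum_mul, Finset.smul_sum]
  refine Finset.sum_congr rfl fun σ _ => ?_
  have h := sign_mul_of_sign (orbitalSignOp_mul_creation S (orb p σ))
    (orbitalSignOp_mul_annihilation S (orb q σ))
  simp only [hS] at h
  exact h

/-- **`e_pqrs` carries the spatial character `χ(p)χ(q)χ(r)χ(s)`**: `U_S e_pqrs = χ(p)χ(q)χ(r)χ(s) · e_pqrs U_S`.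
[cite: Mazziotti2007RDMChapter, §II.F eq. (95)] -/
theorem orbitalSignOp_mul_twoElectronExcitation {S : Finset (Orb Λ)} {S₀ : Finset Λ}
    (hS : ∀ (p : Λ) (σ : Fin 2), orb p σ ∈ S ↔ p ∈ S₀) (p q r s : Λ) :
    orbitalSignOp S * twoElectronExcitation p q r s =
      ((if p ∈ S₀ then (-1 : ℂ) else 1) * (if q ∈ S₀ then (-1 : ℂ) else 1) *
        ((if r ∈ S₀ then (-1 : ℂ) else 1) * (if s ∈ S₀ then (-1 : ℂ) else 1))) •
        (twoElectronExcitation p q r s * orbitalSignOp S) := by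
  unfold twoElectronExcitation
  rw [Finset.mul_sum, Finset.sum_mul, Finset.smul_sum]
  refine Finset.sum_congr rfl fun σ _ => ?_
  rw [Finset.mul_sum, Finset.sum_mul, Finset.smul_sum]
  refine Finset.sum_congr rfl fun τ _ => ?_
  have h1 := sign_mul_of_sign (orbitalSignOp_mul_creation S (orb p σ))
    (orbitalSignOp_mul_creation S (orb r τ))
  have h2 := sign_mul_of_sign h1 (orbitalSignOp_mul_annihilation S (orb s τ))
  have h3 := sign_mul_of_sign h2 (orbitalSignOp_mul_annihilation S (orb q σ))
  simp only [hS, Matrix.mul_assoc] at h3 ⊢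
  rw [h3]
  congr 1
  ring

/-- **The sign-character operator commutes with the molecular Hamiltonian** under the integral
selection rules of an abelian point group: if `h_pq = 0` whenever `χ(p)χ(q) = −1` and `(pq|rs) = 0`
whenever `χ(p)χ(q)χ(r)χ(s) = −1` (integrals between orbitals whose symmetry product is not totally
symmetric are absent from the FCIDUMP file), then `[Ĥ, U_S] = 0`. Knowles–Handy (1989) §2;
Mazziotti (2007) §II.F. [cite: KnowlesHandy1989, §2] -/
theorem orbitalSignOp_commute_molecularHamiltonian {S : Finset (Orb Λ)} {S₀ : Finset Λ}
    (hS : ∀ (p : Λ) (σ : Fin 2), orb p σ ∈ S ↔ p ∈ S₀) {h : Λ → Λ → ℂ} {g : Λ → Λ → Λ → Λ → ℂ}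
    {hnuc : ℂ}
    (h1 : ∀ p q, (if p ∈ S₀ then (-1 : ℂ) else 1) * (if q ∈ S₀ then (-1 : ℂ) else 1) = -1 → h p q = 0)
    (h2 : ∀ p q r s, (if p ∈ S₀ then (-1 : ℂ) else 1) * (if q ∈ S₀ then (-1 : ℂ) else 1) *
      ((if r ∈ S₀ then (-1 : ℂ) else 1) * (if s ∈ S₀ then (-1 : ℂ) else 1)) = -1 → g p q r s = 0) :
    Commute (molecularHamiltonian h g hnuc) (orbitalSignOp S) := by
  unfold molecularHamiltonian
  refine Commute.add_left (Commute.add_left ?_ ?_) ((Commute.one_left _).smul_left _)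
  · refine Commute.sum_left _ _ _ fun p _ => Commute.sum_left _ _ _ fun q _ => ?_
    refine commute_smul_of_sign (orbitalSignOp_mul_singletExcitation hS p q) ?_
    rcases sign_mul_sign_cases (p ∈ S₀) (q ∈ S₀) with hc | hc
    · exact Or.inl hc
    · exact Or.inr (h1 p q hc)
  · refine Commute.smul_left ?_ _
    refine Commute.sum_left _ _ _ fun p _ => Commute.sum_left _ _ _ fun q _ =>
      Commute.sum_left _ _ _ fun r _ => Commute.sum_left _ _ _ fun s _ => ?_
    refine commute_smul_of_sign (orbitalSignOp_mul_twoElectronExcitation hS p q r s) ?_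
    rcases sign_mul_sign_cases (p ∈ S₀) (q ∈ S₀) with hpq | hpq <;>
      rcases sign_mul_sign_cases (r ∈ S₀) (s ∈ S₀) with hrs | hrs
    · left; rw [hpq, hrs, one_mul]
    · right; apply h2; rw [hpq, hrs, one_mul]
    · right; apply h2; rw [hpq, hrs, mul_one]
    · left; rw [hpq, hrs]; norm_num

/-- A symmetry operator commuting with `Ĥ` maps eigenvectors to eigenvectors of the same eigenvalue:
`Ĥ (U_S ψ) = E · U_S ψ` (the eigenspaces of `Ĥ` are `U_S`-invariant — the premise of Mazziotti's
§II.F that the wavefunction of eq. (95) belongs to an irreducible representation).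
[cite: Mazziotti2007RDMChapter, §II.F eq. (95)] -/
theorem orbitalSignOp_mulVec_eigenvector {S : Finset (Orb Λ)}
    {H : Matrix (Finset (Orb Λ)) (Finset (Orb Λ)) ℂ} (hHU : Commute H (orbitalSignOp S))
    {E : ℂ} {ψ : Fock (Orb Λ)} (hψ : H *ᵥ ψ = E • ψ) :
    H *ᵥ (orbitalSignOp S *ᵥ ψ) = E • (orbitalSignOp S *ᵥ ψ) := by
  rw [mulVec_mulVec, hHU.eq, ← mulVec_mulVec, hψ, mulVec_smul]

/-- **Symmetry-adapted vectors always exist in an invariant subspace**: for the involution `U_S`,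
`U_S (ψ + U_S ψ) = ψ + U_S ψ` and `U_S (ψ − U_S ψ) = −(ψ − U_S ψ)`; at least one of the two is nonzero
when `ψ ≠ 0` (`2ψ` is their sum), and by `orbitalSignOp_mulVec_eigenvector` both lie in the eigenspace
of `ψ` when `[Ĥ, U_S] = 0` — which supplies the hypothesis `U_S ψ = ±ψ` of the blocking theorems of
`RDMSpatialSymmetryBlocks.lean` (symmetry adaptation of the wavefunction, Mazziotti (2007) §II.F).
[cite: Mazziotti2007RDMChapter, §II.F eq. (95)] -/
theorem orbitalSignOp_mulVec_symmetrise (S : Finset (Orb Λ)) (ψ : Fock (Orb Λ)) :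
    orbitalSignOp S *ᵥ (ψ + orbitalSignOp S *ᵥ ψ) = (1 : ℂ) • (ψ + orbitalSignOp S *ᵥ ψ) ∧
      orbitalSignOp S *ᵥ (ψ - orbitalSignOp S *ᵥ ψ) = (-1 : ℂ) • (ψ - orbitalSignOp S *ᵥ ψ) := by
  have h2 : orbitalSignOp S *ᵥ (orbitalSignOp S *ᵥ ψ) = ψ := by
    rw [mulVec_mulVec, orbitalSignOp_mul_self, one_mulVec]
  constructor
  · rw [mulVec_add, h2, one_smul, add_comm]
  · rw [mulVec_sub, h2, neg_smul, one_smul, neg_sub]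

end Literature.MathematicalPhysics.QuantumChemistry

end
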